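import Summits.CriticalPhenomena.PercolationContinuityZ3.Theorems.PercNearOneGluingNoHeavyLowerTailSunflowerMultiPetalRestriction
import HarnessLib
import HarnessLib.Audit

/-!
# `NoHeavyLowerTail` (crux stmt-CriticalPhenomena-4575), abstract sunflower cubic, `k` petals: MONOTONICITY OF THE CUBE SLACK
# and the AVERAGED restriction monotonicity (the weakest member of the (MZ) family that still implies ★ₖ)

Support file (seat `prim-l12-p2` gen 31; `--supports stmt-CriticalPhenomena-4575`; companion of `…SunflowerMultiPetalSpectator` (p339016:
`kkK`, `MSunflower.antipodal_sum_nonneg`, `SwK`, `ZK_eq_spec`) and `…SunflowerMultiPetalRestriction` (p340634: `ZKW`, `RestrictionMonotonicityK`)).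
Everything in §1–§2 is PROVED; §3 states one typed conjecture (an obligation of the programme, never a fact) and proves its two reductions.
Memo: run/shared/lean/prim/prim-l12/prim-l12-p2/FINDING-g31-SLACK-MONOTONICITY.md.

In the slot form of ★ₖ (`ZK = 3·SwK [decided] − NtriK`, p339016) the supply at a decided spectator `K` is the ANTIPODAL-GLADKOV SLACK of the cube
`2^{E ∖ K}`.  Here:

* §1 `MSunflower.pslack W G := Σ_{S ⊆ W} kkK (lab (G ∪ S)) (lab (G ∪ (W ∖ S)))` — the (polarised) slack of the cube `2^W` above the offset `G`
  (`pslack W ∅` is the plain slack `Σ_{S ⊆ W} kkK (lab S) (lab (W ∖ S))`); `pslack_nonneg` (= `antipodal_sum_nonneg` on the diagonal).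
* §1 **`pslack_insert`** (this work): for `e ∉ W`, `pslack W G + pslack W (insert e G) ≤ pslack (insert e W) G` — the one-coordinate step of
  Gladkov's induction read as an INEQUALITY BETWEEN CUBES: the slack of `2^{W+e}` dominates the slack of the sub-cube `2^W` plus the slack of the
  FLIPPED sub-cube (both blocks containing `e`).  Hence **`pslack_mono`**: `W' ⊆ W → pslack W' G ≤ pslack W G` — the slack is monotone in the cube;
  in the slot language (`pslack_compl_anti`) the supply at spectator `K` is ANTITONE in `K`, and every cube's slack is at most the top cube's
  (`pslack_le_pslack_univ`).  `SwK_eq_sum_pslack`: the spectator sum of p339016 is `Σ_K w (lab K) · pslack Kᶜ ∅`.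
* §3 `AvgRestrictionMonotonicityK` (OPEN, census-clean; this work): `Σ_{e ∈ W} ZKW (W.erase e) ≤ |W| · ZKW W` — restriction monotonicity ON AVERAGE over
  the deleted coordinate.  It is implied by `RestrictionMonotonicityK` (`avgRestrictionMonotonicityK_of_restrictionMonotonicityK`) and still implies
  ★ₖ (`partitionLemmaK_of_avgRestrictionMonotonicityK`, strong induction on the sub-cube).  In level-average terms it only asks that the average of
  `s6K` over the ordered 3-partitions of `W` be at least ONE THIRD of the average over the 3-partitions of the `(|W|−1)`-sub-cubes; the stronger
  'averages are nondecreasing' form (`|W|·ZKW W ≥ 3·Σ_e ZKW (W.erase e)`) is FALSE (298 of the 3 909 structures on 4 points; memo §2).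
-/

namespace Summit.CriticalPhenomena.PercolationContinuityZ3.Theorems.SunflowerPartition

open Finset

variable {α : Type*} [DecidableEq α]

namespace MSunflower

variable {k : ℕ} (F : MSunflower k α)

/-! ## §1 The polarised cube slack and its monotonicity -/

/-- The (polarised) antipodal-Gladkov slack of the cube `2^W` above the offset `G`:
`Σ_{S ⊆ W} kkK (lab (G ∪ S)) (lab (G ∪ (W ∖ S)))`. [this work] -/
def pslack (W G : Finset α) : ℤ := ∑ S ∈ W.powerset, kkK k (F.lab (G ∪ S)) (F.lab (G ∪ (W \ S)))

/-- The cube slack is nonnegative (antipodal Gladkov with equal offsets). [this work] -/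
theorem pslack_nonneg (W G : Finset α) : 0 ≤ F.pslack W G :=
  F.antipodal_sum_nonneg W G G (subset_refl G)

/-- With the empty offset, `pslack W ∅` is the plain antipodal slack of the cube `2^W`. [this work] -/
theorem pslack_empty_offset (W : Finset α) : F.pslack W ∅ = ∑ S ∈ W.powerset, kkK k (F.lab S) (F.lab (W \ S)) := by
  unfold pslack
  simp only [empty_union]

/-- **One-coordinate step as an inequality between cubes**: for `e ∉ W`, the slack of `2^{W+e}` above `G` dominates the slack of
`2^W` above `G` plus the slack of `2^W` above `G + e` (Gladkov's submodularity step, summed). [this work] -/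
theorem pslack_insert {W : Finset α} (G : Finset α) {e : α} (he : e ∉ W) :
    F.pslack W G + F.pslack W (insert e G) ≤ F.pslack (insert e W) G := by
  unfold pslack
  rw [sum_powerset_insert he]
  have key : ∀ S ∈ W.powerset,
      kkK k (F.lab (G ∪ S)) (F.lab (G ∪ (W \ S))) + kkK k (F.lab (insert e G ∪ S)) (F.lab (insert e G ∪ (W \ S)))
        ≤ kkK k (F.lab (G ∪ S)) (F.lab (G ∪ (insert e W \ S)))
          + kkK k (F.lab (G ∪ insert e S)) (F.lab (G ∪ (insert e W \ insert e S))) := by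
    intro S hS
    have hSW : S ⊆ W := mem_powerset.1 hS
    have heS : e ∉ S := fun hx => he (hSW hx)
    rw [Sunflower.union_insert_sdiff heS, Sunflower.insert_sdiff_insert_of_not_mem he, Sunflower.union_insert_eq]
    have h1 := F.lab_mono (union_subset_union (subset_insert e G) (subset_refl S))
    have h2 := F.lab_mono (union_subset_union (subset_insert e G) (subset_refl (W \ S)))
    have := kkK_submod _ _ _ _ h1 h2
    linarith
  have hsum := sum_le_sum key
  rw [sum_add_distrib, sum_add_distrib] at hsum
  exact hsum

/-- The slack of a cube dominates the slack of each of its one-point-smaller sub-cubes (same offset). [this work] -/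
theorem pslack_le_pslack_insert {W : Finset α} (G : Finset α) {e : α} (he : e ∉ W) :
    F.pslack W G ≤ F.pslack (insert e W) G := by
  have h1 := F.pslack_insert G he
  have h2 := F.pslack_nonneg W (insert e G)
  linarith

/-- **Monotonicity of the cube slack**: `W' ⊆ W → pslack W' G ≤ pslack W G`. [this work] -/
theorem pslack_mono {W W' : Finset α} (G : Finset α) (h : W' ⊆ W) : F.pslack W' G ≤ F.pslack W G := by
  have key : ∀ D : Finset α, Disjoint D W' → F.pslack W' G ≤ F.pslack (W' ∪ D) G := by
    intro D
    induction D using Finset.induction_on with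
    | empty => intro _; rw [union_empty]
    | insert e D' he ih =>
      intro hd
      have hd' : Disjoint D' W' := Disjoint.mono_left (subset_insert e D') hd
      have heW' : e ∉ W' := Finset.disjoint_left.1 hd (mem_insert_self e D')
      have he' : e ∉ W' ∪ D' := by
        rw [mem_union, not_or]; exact ⟨heW', he⟩
      rw [union_insert]
      exact le_trans (ih hd') (F.pslack_le_pslack_insert G he')
  have hW : W' ∪ (W \ W') = W := union_sdiff_of_subset h
  have := key (W \ W') disjoint_sdiff_self_left
  rwa [hW] at this

variable [Fintype α]

/-- In the slot language: the supply at spectator `K` (the slack of the cube `2^{E ∖ K}`) is ANTITONE in `K`. [this work] -/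
theorem pslack_compl_anti {K K' : Finset α} (G : Finset α) (h : K ⊆ K') : F.pslack K'ᶜ G ≤ F.pslack Kᶜ G :=
  F.pslack_mono G (compl_subset_compl.2 h)

/-- Every cube's slack is at most the top cube's slack. [this work] -/
theorem pslack_le_pslack_univ (W G : Finset α) : F.pslack W G ≤ F.pslack univ G :=
  F.pslack_mono G (subset_univ W)

/-- The spectator sum of p339016 as a sum of cube slacks: `SwK w = Σ_K w (lab K) · pslack Kᶜ ∅`. [this work] -/
theorem SwK_eq_sum_pslack (w : Fin (k + 2) → ℤ) : F.SwK w = ∑ K : Finset α, w (F.lab K) * F.pslack Kᶜ ∅ := by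
  unfold SwK
  rw [Sunflower.sum_parts_eq (f := fun S T => w (F.lab S) * kkK k (F.lab T) (F.lab (S ∪ T)ᶜ))]
  refine sum_congr rfl fun K _ => ?_
  rw [pslack_empty_offset, mul_sum]
  refine sum_congr rfl fun T _ => ?_
  rw [compl_union, sdiff_eq_inter_compl, inter_comm]

/-- Corollary: a spectator sum with nonnegative weights is at most (total weight) × (top-cube slack). [this work] -/
theorem SwK_le_card_mul_pslack_univ (w : Fin (k + 2) → ℤ) (hw : ∀ v, 0 ≤ w v) :
    F.SwK w ≤ (∑ K : Finset α, w (F.lab K)) * F.pslack univ ∅ := by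
  rw [F.SwK_eq_sum_pslack, sum_mul]
  exact sum_le_sum fun K _ => mul_le_mul_of_nonneg_left (F.pslack_le_pslack_univ Kᶜ ∅) (hw _)

end MSunflower

/-! ## §3 Averaged restriction monotonicity -/

/-- **AVERAGED RESTRICTION MONOTONICITY** (this work; OPEN; census-clean: all structures on `≤ 4` points exhaustively, random 5-point
structures; implied by the exhaustively checked `RestrictionMonotonicityK`): for every monotone map into `M_k` and every sub-cube `W`,
`Σ_{e ∈ W} ZKW (W.erase e) ≤ |W| · ZKW W` — deleting a UNIFORMLY RANDOM coordinate does not increase the sub-cube functional on average.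
Weaker than `RestrictionMonotonicityK` (`avgRestrictionMonotonicityK_of_restrictionMonotonicityK`), still sufficient for ★ₖ
(`partitionLemmaK_of_avgRestrictionMonotonicityK`).  An obligation, never a fact: use as `(h : AvgRestrictionMonotonicityK)`. [status: open] -/
@[conjecture] def AvgRestrictionMonotonicityK : Prop :=
  ∀ (k : ℕ) (α : Type) [Fintype α] [DecidableEq α] (F : MSunflower k α) (W : Finset α),
    ∑ e ∈ W, F.ZKW (W.erase e) ≤ (W.card : ℤ) * F.ZKW W

/-- `RestrictionMonotonicityK` implies its average. [this work] -/
theorem avgRestrictionMonotonicityK_of_restrictionMonotonicityK (h : RestrictionMonotonicityK) : AvgRestrictionMonotonicityK := by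
  intro k α _ _ F W
  have hle : ∀ e ∈ W, F.ZKW (W.erase e) ≤ F.ZKW W := by
    intro e he
    have := h k α F (W.erase e) e (notMem_erase e W)
    rwa [insert_erase he] at this
  calc ∑ e ∈ W, F.ZKW (W.erase e) ≤ ∑ _e ∈ W, F.ZKW W := sum_le_sum hle
    _ = (W.card : ℤ) * F.ZKW W := by rw [sum_const, nsmul_eq_mul]

/-- **Averaged restriction monotonicity ⟹ ★ₖ** (strong induction on the sub-cube: if every `(|W|−1)`-sub-cube has a nonnegative functional,
so has `W`). [this work] -/
theorem partitionLemmaK_of_avgRestrictionMonotonicityK (h : AvgRestrictionMonotonicityK) : PartitionLemmaK := by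
  intro k α _ _ F
  rw [← F.ZKW_univ]
  have main : ∀ W : Finset α, 0 ≤ F.ZKW W := by
    intro W
    induction W using Finset.strongInduction with
    | H W ih =>
      rcases W.eq_empty_or_nonempty with hW | hW
      · rw [hW, F.ZKW_empty]
      · have hsum : 0 ≤ ∑ e ∈ W, F.ZKW (W.erase e) :=
          sum_nonneg fun e he => ih (W.erase e) (erase_ssubset he)
        have hcard : (0 : ℤ) < W.card := by exact_mod_cast hW.card_pos
        have hmul : 0 ≤ (W.card : ℤ) * F.ZKW W := le_trans hsum (h k α F W)
        by_contra hneg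
        have hneg' : F.ZKW W < 0 := lt_of_not_ge hneg
        have : (W.card : ℤ) * F.ZKW W < 0 := mul_neg_of_pos_of_neg hcard hneg'
        linarith
  exact main univ

end Summit.CriticalPhenomena.PercolationContinuityZ3.Theorems.SunflowerPartition
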